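import Literature.Probability.Percolation.IsoradialArmUniversalityReduction
import Literature.Probability.Percolation.IsoradialUniverseTransferArms
import HarnessLib

/-!
# `gm_universality_arms` modulo Proposition 22: arbitrary universes

Grimmett–Manolescu, *Bond percolation on isoradial graphs: criticality and universality*,
PTRF 159 (2014) 273–327 = arXiv:1204.0505, §3 Theorem 6 (Universality) (a) for `π = ρ_{2j}`:
"If `π` exists for some `G ∈ 𝒢`, then it is `𝒢`-invariant"; printed proof (§8.1): "Part (a) …
is an immediate consequence" of Proposition 22 (Prop. 8.1, exp_transport). In the tree,
Proposition 22 is the pair of named facts `GrimmettManolescu2014_armComparability_one_two`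
(`k ∈ {1, 2}`) and `GrimmettManolescu2014_altArmComparability` (`k = 2j ≥ 4`), quantifying over
graphs on types in `Type`, and the deduction has been formalised in three steps:
`IsoradialExponentUniversality` (centred embeddings on `Type`),
`IsoradialArmUniversalityReduction` (arbitrary position, `Type`:
`gm_universality_altArms_of_armComparability`), and the present file, which removes the last
formalisation-side restriction — **universes** — and reaches the per-graph fact
`gm_universality_arms` of `Isoradial` (crit-perc.S24; restated in place on 2026-08-15 with the
cluster-separated events `RhombicEmbedding.embAltArmEvent` and the printed square-grid
property, `V F : Type*`) itself:

* `gm_universality_altArms_of_armComparability_univ` — the body of `gm_universality_arms` with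
  its instance binders as section hypotheses, for `V F : Type*`, from the two facts: copy `G`
  onto types in `Type` with the same class data and the same alternating arm probabilities
  (`exists_type_copy_embAltArmEvent`, `IsoradialUniverseTransferArms`: `V ↪ ℕ`, `F ↪ ℂ`,
  transport of the embedding, of `P_G` and of the events) and apply the `Type`-level theorem;
* **`gm_universality_arms_of_armComparability (h12) (h4) : gm_universality_arms G emb ε`** — the
  tree fact under the two Proposition-22 facts, so that its discharge needs exactly theirs
  (§§5–8: star–triangle transport, separation theorem, box-crossing property) and nothing else;
* `gm_universality_arms_one_of_armComparability_one_two_univ` — the `j = 1` case in the form of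
  the prelude's event `embArmEvent (alternatingColours 1)` (`= embAltArmEvent 1`,
  `RhombicEmbedding.embAltArmEvent_one_eq`), from the `k ∈ {1, 2}` fact alone, `V F : Type*`.

Theorems only; nothing is assumed beyond the two named facts, taken as hypotheses.

## References

* G. R. Grimmett, I. Manolescu, *Bond percolation on isoradial graphs: criticality and
  universality*, PTRF 159 (2014) 273–327, arXiv:1204.0505: §3 Theorem 6 (Universality) (a);
  §8.1 Prop. 8.1 (exp_transport), "immediate consequence"; §8.2 Prop. 8.2.
-/

noncomputable section

open MeasureTheory

namespace Literature.Probability.Percolation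

open LatticeModels Percolation

/-! ### The corrected statement in every universe -/

section Univ

variable {V F : Type*} [Countable V] [DecidableEq V] [DecidableEq F] (G : SimpleGraph V)
  [G.LocallyFinite] (emb : RhombicEmbedding G F) (ε : ℝ)

/-- **§8.1 ⟹ §3 Theorem 6(a), `π = ρ_{2j}`, for graphs on types in arbitrary universes.** The
body of the tree fact `gm_universality_arms` (`Isoradial`; Grimmett–Manolescu 2014, Theorem 6
(Universality) (a) for the alternating arm exponents, events `embAltArmEvent`, printed
square-grid property at `G` and at the witness `G₀ : Type`) with its two instance binders
`Countable V`, `G.LocallyFinite` as section hypotheses, for `V F : Type*`, under the two named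
facts transcribing Proposition 22. Proof: `exists_type_copy_embAltArmEvent`
(`IsoradialUniverseTransferArms`) produces an isomorphic copy of `G` on types in `Type` with the
same class data and the same alternating arm probabilities, to which
`gm_universality_altArms_of_armComparability` (`IsoradialArmUniversalityReduction`) applies.
[cite: GrimmettManolescu2014Isoradial, §3 Thm 6 (Universality) (a), π = ρ_{2j}, via §8.1 Prop. 8.1] -/
theorem gm_universality_altArms_of_armComparability_univ
    (h12 : GrimmettManolescu2014_armComparability_one_two)
    (h4 : GrimmettManolescu2014_altArmComparability) :
    ∀ (_ : G.Preconnected) (_ : emb.IsIsoradial) (_ : emb.IsRhombicTiling) (_ : 0 < ε)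
      (_ : emb.HasBoundedAngles ε) (_ : emb.HasSquareGridPropertyGM) (j : ℕ) (_ : 1 ≤ j)
      (α : ℝ)
      (_ : ∃ (V₀ F₀ : Type) (_ : Countable V₀) (_ : DecidableEq V₀) (_ : DecidableEq F₀)
        (G₀ : SimpleGraph V₀) (_ : G₀.LocallyFinite) (emb₀ : RhombicEmbedding G₀ F₀) (ε₀ : ℝ),
        G₀.Preconnected ∧ emb₀.IsIsoradial ∧ emb₀.IsRhombicTiling ∧ 0 < ε₀ ∧
          emb₀.HasBoundedAngles ε₀ ∧ emb₀.HasSquareGridPropertyGM ∧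
          ∃ r₁ : ℕ, ∀ r₀ ≥ r₁, HasDecayExponent
            (fun R => emb₀.isoradialPercolation.real (emb₀.embAltArmEvent j r₀ R)) α),
      ∃ r₁ : ℕ, ∀ r₀ ≥ r₁, HasDecayExponent
        (fun R => emb.isoradialPercolation.real (emb.embAltArmEvent j r₀ R)) α := by
  intro hconn hiso hrh hε hbap hsgp j hj α hex
  obtain ⟨V₁, F₁, i₁, i₂, i₃, G₁, i₄, emb₁, e, hconn₁, hiso₁, hrh₁, hbap₁, hsgp₁, -, hreal⟩ :=
    exists_type_copy_embAltArmEvent emb hiso hrh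
  obtain ⟨I, hI⟩ := hsgp
  have key := gm_universality_altArms_of_armComparability h12 h4 G₁ emb₁ ε (hconn₁ hconn) hiso₁
    hrh₁ hε (hbap₁ ε hbap) ⟨I, hsgp₁ I hI⟩ j hj α hex
  simpa only [hreal] using key

/-- **The `j = 1` case in the prelude's event form, arbitrary universes, from Prop. 8.1
(`k = 2`) alone.** For two arms the prelude's event `embArmEvent (alternatingColours 1) r₀ R`
(the event of the superseded body of `gm_universality_arms`) *is* the alternating event
`embAltArmEvent 1 r₀ R` (`RhombicEmbedding.embAltArmEvent_one_eq`); this is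
`gm_universality_arms_one_of_armComparability_one_two` (`IsoradialArmUniversalityReduction`,
`V F : Type`) carried to `V F : Type*` through the `Type` copy. Grimmett–Manolescu 2014,
Theorem 6(a) for `π = ρ_2`. (Nothing is claimed for the prelude's event with `j ≥ 2`, which is
not `A_{2j}`: *History* paragraph of the docstring of `gm_universality_arms`.)
[cite: GrimmettManolescu2014Isoradial, §3 Thm 6 (Universality) (a), π = ρ_2, via §8.1 Prop. 8.1 (k = 2)] -/
theorem gm_universality_arms_one_of_armComparability_one_two_univ
    (h12 : GrimmettManolescu2014_armComparability_one_two) :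
    ∀ (_ : G.Preconnected) (_ : emb.IsIsoradial) (_ : emb.IsRhombicTiling) (_ : 0 < ε)
      (_ : emb.HasBoundedAngles ε) (_ : emb.HasSquareGridPropertyGM) (α : ℝ)
      (_ : ∃ (V₀ F₀ : Type) (_ : Countable V₀) (_ : DecidableEq V₀) (_ : DecidableEq F₀)
        (G₀ : SimpleGraph V₀) (_ : G₀.LocallyFinite) (emb₀ : RhombicEmbedding G₀ F₀) (ε₀ : ℝ),
        G₀.Preconnected ∧ emb₀.IsIsoradial ∧ emb₀.IsRhombicTiling ∧ 0 < ε₀ ∧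
          emb₀.HasBoundedAngles ε₀ ∧ emb₀.HasSquareGridPropertyGM ∧
          ∃ r₁ : ℕ, ∀ r₀ ≥ r₁, HasDecayExponent (fun R => emb₀.isoradialPercolation.real
            (emb₀.embArmEvent (alternatingColours 1) r₀ R)) α),
      ∃ r₁ : ℕ, ∀ r₀ ≥ r₁, HasDecayExponent (fun R => emb.isoradialPercolation.real
        (emb.embArmEvent (alternatingColours 1) r₀ R)) α := by
  intro hconn hiso hrh hε hbap hsgp α hex
  obtain ⟨V₁, F₁, i₁, i₂, i₃, G₁, i₄, emb₁, e, hconn₁, hiso₁, hrh₁, hbap₁, hsgp₁, -, hreal⟩ :=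
    exists_type_copy_embAltArmEvent emb hiso hrh
  obtain ⟨I, hI⟩ := hsgp
  have key := gm_universality_arms_one_of_armComparability_one_two h12 G₁ emb₁ ε (hconn₁ hconn)
    hiso₁ hrh₁ hε (hbap₁ ε hbap) ⟨I, hsgp₁ I hI⟩ α hex
  simp_rw [← RhombicEmbedding.embAltArmEvent_one_eq] at key ⊢
  simpa only [hreal] using key

end Univ

/-! ### The tree fact, modulo Proposition 22 -/

section Fact

variable {V F : Type*} [DecidableEq V] [DecidableEq F] (G : SimpleGraph V)
  (emb : RhombicEmbedding G F) (ε : ℝ)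

/-- **`gm_universality_arms` from Proposition 22.** The per-graph fact of `Isoradial`
(crit-perc.S24; Grimmett–Manolescu 2014, §3 Theorem 6 (Universality) (a) for `π = ρ_{2j}`,
`j ≥ 1`, as restated in place on 2026-08-15) holds for every `G`, `emb`, `ε` under the two named
facts vendoring Proposition 22 — `GrimmettManolescu2014_armComparability_one_two` (§8.1
Prop. 8.1 with §8.2 Prop. 8.2, `k ∈ {1, 2}`) and `GrimmettManolescu2014_altArmComparability`
(`k = 2j ≥ 4`) —: the printed one-line proof ("Part (a) … is an immediate consequence", §8.1)
carried out in the tree's rendering (arbitrary centre: `IsoradialTranslation`,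
`IsoradialArmUniversalityReduction`; arbitrary universes: `IsoradialUniverseTransferArms`;
log-ratio limits tolerant of vanishing terms). Consequently the discharge
`gm_universality_arms_holds` needs exactly the discharges of those two facts (Proposition 22:
§§5–8) and nothing else.
[cite: GrimmettManolescu2014Isoradial, §3 Thm 6 (Universality) (a), π = ρ_{2j}; §8.1 ("immediate consequence" of Prop. 22)] -/
theorem gm_universality_arms_of_armComparability
    (h12 : GrimmettManolescu2014_armComparability_one_two)
    (h4 : GrimmettManolescu2014_altArmComparability) : gm_universality_arms G emb ε := by
  intro _ _ hconn hiso hrh hε hbap hsgp j hj α hex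
  exact gm_universality_altArms_of_armComparability_univ G emb ε h12 h4 hconn hiso hrh hε hbap
    hsgp j hj α hex

end Fact

end Literature.Probability.Percolation

end
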